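import Literature.RepresentationTheory.CompactGroups.SchurOrthogonality
import HarnessLib

/-!
# The multiplicity formula `dim Hom_G(V, W) = ∫ conj χ_V · χ_W` for compact groups, and its consequences

Topic `Literature/RepresentationTheory/CompactGroups`; namespace `Literature.RepresentationTheory.CompactGroups.Schur`
(continues `SchurOrthogonality`).  Theorems and auxiliary definitions (`conjCLM`, `avgOp`, `vecAvg`, `intertwiners`,
`intertwinersEquiv`); no named fact.

T. Bröcker, T. tom Dieck, *Representations of Compact Lie Groups* (GTM 98, 1985), Ch. II §4 (PDF pp. 76–80):
(4.1) the averaging operator `p : V → V^G`, `v ↦ ∫ g v dg` (and on `Hom(V, W)`, `f ↦ ∫ g·f dg`) is a PROJECTION onto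
the invariants; (4.10) isomorphic representations have equal characters, `χ_V(g⁻¹) = conj χ_V(g)` (unitary `V`),
characters are class functions; (4.11) **Theorem**: for (continuous, finite-dimensional) representations `V`, `W` of
the compact group `G`, (i) `∫ χ_V(g) dg = dim V^G`, (ii) `⟨χ_W, χ_V⟩ = ∫ conj χ_V(g) χ_W(g) dg = dim Hom_G(V, W)`,
(iii) for irreducible `V`, `W`: `∫ conj χ_V χ_W = 1` if `V ≅ W` and `0` otherwise; (4.12) `V ≅ W` iff `χ_V = χ_W`;
(4.13) **Proposition**: `⟨χ_V, χ_V⟩ = 1` implies `V` irreducible.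
Proof of (4.11) as printed: `dim V^G = Tr p` (trace of a projection = dimension of its range) and, the trace commuting
with the integral, `Tr p = ∫ Tr(l_g) dg = ∫ χ_V`; (ii) is (i) for `Hom(V, W) ≅ V* ⊗ W`, whose character is
`conj χ_V · χ_W`.  For (4.13) we do not decompose into irreducibles (as the book does) but argue directly:
`dim End_G(V) = ⟨χ_V, χ_V⟩ = 1`, while a proper non-zero invariant `W ⊆ V` (unitary `V`) has the orthogonal
projection onto `W` as a non-scalar intertwiner.

* `Schur.character_eq_toRepresentation_character` — `Schur.character π` is (definitionally) Mathlib's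
  `Representation.character` of `π.toRepresentation`, whose calculus we reuse: `Schur.trace_conjCLM_rep` — the operator
  `f ↦ σ g ∘ f ∘ π g⁻¹` on `E →L[ℂ] F` has trace `χ_π(g⁻¹) χ_σ(g)` (Mathlib `Representation.char_linHom`, i.e.
  `Hom(V, W) ≅ V* ⊗ W`); `Schur.character_eq_of_equiv` (II (4.10) (ii), Mathlib `char_iso`);
  `Schur.character_inv` — `χ_π(g⁻¹) = conj χ_π(g)` for unitary `π` (II (4.10) (vii)); `Schur.character_conj` — class
  function (II (4.10) (iii)); `Schur.character_one` (II (4.10) (viii));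
* `Schur.vecAvg μ π = (v ↦ ∫ π g v dμ)`, `Schur.isProj_vecAvg` — **II (4.1)**: a projection of `E` onto Mathlib's
  `Representation.invariants`; `Schur.finrank_invariants_eq_integral_character` — **II Thm. (4.11)(i)**:
  `dim_ℂ V^G = ∫ χ_V dμ`;
* `Schur.avgOp μ π σ = (f ↦ ∫ σ g ∘ f ∘ π g⁻¹ dμ)` on `E →L[ℂ] F` (`avgOp f = Schur.avg f`), `Schur.isProj_avgOp` —
  **II (4.1)**: a projection onto the subspace `Schur.intertwiners π σ` of intertwining operators;
* `Schur.finrank_intertwiners_eq_integral` — **II Thm. (4.11)(ii)**: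
  `dim_ℂ (intertwiners π σ) = ∫ conj χ_π(g) · χ_σ(g) dμ(g)` for unitary `π` (any finite-dimensional continuous `σ`);
  `Schur.finrank_intertwiningMap_eq_integral` — the same for Mathlib's `Representation.IntertwiningMap`
  (`Schur.intertwinersEquiv`: in finite dimension every linear intertwiner is continuous);
  `Schur.nonempty_intertwiners_ne_zero_iff` — a non-zero intertwiner exists iff `∫ conj χ_π χ_σ ≠ 0`;
* `Schur.integral_conj_character_mul_character_of_equiv` — **II Thm. (4.11)(iii)**, isomorphic case (`= 1`; the
  non-isomorphic case `= 0` is `SchurOrthogonality`'s `integral_conj_character_mul_character_eq_zero`);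
* (4.12) itself — representations with equal characters are isomorphic — holds for all finite-dimensional
  semisimple representations in characteristic `0` (Brauer–Nesbitt) and is the tree's
  `Representation.nonempty_equiv_iff_character_eq_of_isSemisimple` (`Literature/RepresentationTheory/Semisimple/EquivOfCharacter`;
  semisimplicity here by `CompactGroups/FiniteDimensionalSemisimple`); it is not repeated;
* `Schur.isIrreducible_iff_integral_conj_character_mul_character_eq_one` — **II Prop. (4.13)** with (4.11)(iii): a
  unitary `π` is irreducible iff `∫ |χ_π|² dμ = 1` (`Schur.starProjection_apply_comm`: the orthogonal projection onto an
  invariant subspace of a unitary representation is an intertwiner).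

## References
* T. Bröcker, T. tom Dieck, *Representations of Compact Lie Groups*, GTM 98 (1985), II (4.1), (4.10)–(4.13),
  PDF pp. 76–80 [BrockerTomDieck1985].
* G. B. Folland, *A Course in Abstract Harmonic Analysis* (1995), §5.3 [Folland1995].

## Provenance
Lane `lit-hodgefound` (HOME `run/shared/lean/pub/lit-hodgefound/`), prover seat `lit-hodgefound-p05` generation 6 (Layer 0:
compact groups — multiplicities of `K`-types).
-/

noncomputable section

open MeasureTheory ContinuousLinearMap Complex
open scoped InnerProductSpace ComplexConjugate

namespace Literature.RepresentationTheory.CompactGroups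

namespace Schur

/-! ### The conjugation operator `f ↦ A ∘ f ∘ B` on `E →L[ℂ] F` -/

section ConjCLM

variable {E F : Type*} [NormedAddCommGroup E] [NormedSpace ℂ E] [NormedAddCommGroup F] [NormedSpace ℂ F]

/-- The continuous-linear operator `f ↦ A ∘ f ∘ B` on `E →L[ℂ] F` (the action `g·f = l_g ∘ f ∘ l_g⁻¹` of
Bröcker–tom Dieck II §4 on `Hom(V, W)`, for one pair of operators). [cite: BrockerTomDieck1985, II (4.1)] -/
def conjCLM (A : F →L[ℂ] F) (B : E →L[ℂ] E) : (E →L[ℂ] F) →L[ℂ] (E →L[ℂ] F) :=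
  (ContinuousLinearMap.compL ℂ E F F A).comp ((ContinuousLinearMap.compL ℂ E E F).flip B)

/-- Unfolding `conjCLM`. [cite: BrockerTomDieck1985, II (4.1)] -/
@[simp] theorem conjCLM_apply (A : F →L[ℂ] F) (B : E →L[ℂ] E) (f : E →L[ℂ] F) :
    conjCLM A B f = A.comp (f.comp B) := by
  simp [conjCLM]

end ConjCLM

/-! ### Characters: the bridge to Mathlib's `Representation.character`; `χ(g⁻¹) = conj χ(g)` for unitary `π` -/

section CharacterBasics

variable {G : Type*} [Group G]
variable {E : Type*} [NormedAddCommGroup E] [InnerProductSpace ℂ E] [FiniteDimensional ℂ E]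
variable {π : ContRepresentation ℂ G E}

variable (π) in
omit [FiniteDimensional ℂ E] in
/-- `Schur.character π` **is** Mathlib's `Representation.character` of `π.toRepresentation` (definitionally), so
Mathlib's character calculus (`char_iso`, `char_conj`, `char_linHom`, …) applies. [cite: BrockerTomDieck1985, II (4.9)] -/
theorem character_eq_toRepresentation_character : character π = π.toRepresentation.character := rfl

/-- **`χ_π(g⁻¹) = conj χ_π(g)` for a unitary `π`** (Bröcker–tom Dieck II (4.10) (vii); `⟪b i, π g⁻¹ (b i)⟫ = conj ⟪b i, π g (b i)⟫`
in an orthonormal basis). [cite: BrockerTomDieck1985, II Prop (4.10)] -/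
theorem character_inv (hu : ∀ (g : G) (v w : E), ⟪π g v, π g w⟫_ℂ = ⟪v, w⟫_ℂ) (g : G) :
    character π g⁻¹ = conj (character π g) := by
  classical
  rw [character_eq_sum_inner (stdOrthonormalBasis ℂ E), character_eq_sum_inner (stdOrthonormalBasis ℂ E), map_sum]
  exact Finset.sum_congr rfl fun i _ => inner_apply_inv_eq_conj hu g _ _

/-- `χ_π(1) = dim E`. [cite: BrockerTomDieck1985, II Prop (4.10)] -/
theorem character_one : character π 1 = (Module.finrank ℂ E : ℂ) := by
  rw [character, map_one, ContinuousLinearMap.toLinearMap_one, LinearMap.trace_one]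

omit [FiniteDimensional ℂ E] in
/-- **Characters are class functions**: `χ_π(g x g⁻¹) = χ_π(x)` (Bröcker–tom Dieck II (4.10) (iii)).
[cite: BrockerTomDieck1985, II Prop (4.10)] -/
theorem character_conj (g x : G) : character π (g * x * g⁻¹) = character π x := by
  simp only [character, map_mul, ContinuousLinearMap.toLinearMap_mul]
  rw [mul_assoc, LinearMap.trace_mul_comm, mul_assoc, ← ContinuousLinearMap.toLinearMap_mul, ← map_mul,
    inv_mul_cancel, map_one, ContinuousLinearMap.toLinearMap_one, mul_one]

end CharacterBasics

/-! ### The averaging operator on `Hom(E, F)` is a projection onto the intertwiners (II (4.1)) -/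

section Projection

variable {G : Type*} [Group G] [TopologicalSpace G] [IsTopologicalGroup G] [MeasurableSpace G] [BorelSpace G]
  [CompactSpace G]
variable {E F : Type*} [NormedAddCommGroup E] [InnerProductSpace ℂ E] [FiniteDimensional ℂ E]
  [NormedAddCommGroup F] [InnerProductSpace ℂ F] [FiniteDimensional ℂ F]
variable (μ : Measure G) [IsProbabilityMeasure μ] [μ.IsMulLeftInvariant]
variable {π : ContRepresentation ℂ G E} {σ : ContRepresentation ℂ G F}

variable (π σ) in
/-- **The averaging operator on `Hom(E, F)`**, `p : f ↦ ∫ σ g ∘ f ∘ π g⁻¹ dμ(g) = avg f`, as a linear endomorphism of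
`E →L[ℂ] F` (Bröcker–tom Dieck II (4.1)). [cite: BrockerTomDieck1985, II (4.1)] -/
def avgOp (hπ : Continuous (π : G → E →L[ℂ] E)) (hσ : Continuous (σ : G → F →L[ℂ] F)) :
    (E →L[ℂ] F) →ₗ[ℂ] (E →L[ℂ] F) where
  toFun := avg μ π σ
  map_add' f₁ f₂ := by
    unfold avg
    rw [← integral_add (integrable_conjOp μ hπ hσ f₁) (integrable_conjOp μ hπ hσ f₂)]
    refine integral_congr_ae (Filter.Eventually.of_forall fun g => ?_)
    simp only [ContinuousLinearMap.add_comp, ContinuousLinearMap.comp_add]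
  map_smul' c f := by
    unfold avg
    rw [RingHom.id_apply, ← integral_smul]
    refine integral_congr_ae (Filter.Eventually.of_forall fun g => ?_)
    simp only [ContinuousLinearMap.smul_comp, ContinuousLinearMap.comp_smul]

omit [FiniteDimensional ℂ E] [FiniteDimensional ℂ F] [μ.IsMulLeftInvariant] in
/-- `avgOp f = avg f`. [cite: BrockerTomDieck1985, II (4.1)] -/
@[simp] theorem avgOp_apply (hπ : Continuous (π : G → E →L[ℂ] E)) (hσ : Continuous (σ : G → F →L[ℂ] F))
    (f : E →L[ℂ] F) : avgOp μ π σ hπ hσ f = avg μ π σ f := rfl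

variable (π σ) in
/-- The subspace of **intertwining operators** `{f | σ g ∘ f = f ∘ π g for all g}` of `E →L[ℂ] F`
(`Hom_G(V, W)` of Bröcker–tom Dieck II (4.1)). [cite: BrockerTomDieck1985, II (4.1)] -/
def intertwiners : Submodule ℂ (E →L[ℂ] F) where
  carrier := {f | ∀ g : G, (σ g).comp f = f.comp (π g)}
  add_mem' {f₁ f₂} h₁ h₂ g := by rw [ContinuousLinearMap.comp_add, ContinuousLinearMap.add_comp, h₁ g, h₂ g]
  zero_mem' g := by rw [ContinuousLinearMap.comp_zero, ContinuousLinearMap.zero_comp]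
  smul_mem' c f hf g := by rw [ContinuousLinearMap.comp_smul, ContinuousLinearMap.smul_comp, hf g]

omit [TopologicalSpace G] [IsTopologicalGroup G] [MeasurableSpace G] [BorelSpace G] [CompactSpace G]
  [FiniteDimensional ℂ E] [FiniteDimensional ℂ F] in
/-- Membership in `intertwiners`. [cite: BrockerTomDieck1985, II (4.1)] -/
theorem mem_intertwiners {f : E →L[ℂ] F} : f ∈ intertwiners π σ ↔ ∀ g : G, (σ g).comp f = f.comp (π g) :=
  Iff.rfl

omit [FiniteDimensional ℂ E] in
/-- The averaged operator is an intertwiner. [cite: BrockerTomDieck1985, II (4.1)] -/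
theorem avg_mem_intertwiners (hπ : Continuous (π : G → E →L[ℂ] E)) (hσ : Continuous (σ : G → F →L[ℂ] F))
    (f : E →L[ℂ] F) : avg μ π σ f ∈ intertwiners π σ := fun g => comp_avg μ hπ hσ f g

omit [TopologicalSpace G] [IsTopologicalGroup G] [BorelSpace G] [CompactSpace G] [FiniteDimensional ℂ E]
  [μ.IsMulLeftInvariant] in
/-- The averaging fixes intertwiners: `σ g ∘ f ∘ π g⁻¹ = f` for all `g`, and `μ` is a probability measure.
[cite: BrockerTomDieck1985, II (4.1)] -/
theorem avg_eq_self_of_mem {f : E →L[ℂ] F} (hf : f ∈ intertwiners π σ) : avg μ π σ f = f := by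
  haveI : CompleteSpace F := FiniteDimensional.complete ℂ F
  have h : ∀ g : G, (σ g).comp (f.comp (π g⁻¹)) = f := fun g => by
    rw [← ContinuousLinearMap.comp_assoc, hf g, ContinuousLinearMap.comp_assoc, ← ContinuousLinearMap.mul_def,
      ← map_mul, mul_inv_cancel, map_one, ContinuousLinearMap.one_def, ContinuousLinearMap.comp_id]
  unfold avg
  simp_rw [h]
  simp

omit [FiniteDimensional ℂ E] in
/-- **Bröcker–tom Dieck II (4.1): the averaging operator is a projection of `Hom(E, F)` onto `Hom_G(E, F)`.**
[cite: BrockerTomDieck1985, II (4.1)] -/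
theorem isProj_avgOp (hπ : Continuous (π : G → E →L[ℂ] E)) (hσ : Continuous (σ : G → F →L[ℂ] F)) :
    LinearMap.IsProj (intertwiners π σ) (avgOp μ π σ hπ hσ) where
  map_mem f := avg_mem_intertwiners μ hπ hσ f
  map_id _ hf := avg_eq_self_of_mem μ hf

/-- Hence `Tr(avgOp) = dim Hom_G(E, F)` (trace of a projection, Mathlib `LinearMap.IsProj.trace`).
[cite: BrockerTomDieck1985, II (4.11)] -/
theorem trace_avgOp (hπ : Continuous (π : G → E →L[ℂ] E)) (hσ : Continuous (σ : G → F →L[ℂ] F)) :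
    LinearMap.trace ℂ (E →L[ℂ] F) (avgOp μ π σ hπ hσ) = (Module.finrank ℂ (intertwiners π σ) : ℂ) :=
  (isProj_avgOp μ hπ hσ).trace

omit [TopologicalSpace G] [IsTopologicalGroup G] [MeasurableSpace G] [BorelSpace G] [CompactSpace G] in
/-- The trace of the conjugation action at `g`: `Tr(f ↦ σ g ∘ f ∘ π g⁻¹) = χ_π(g⁻¹) χ_σ(g)` — the character of
`Hom(V, W) ≅ V* ⊗ W` (Bröcker–tom Dieck II (4.10) (v)–(vi); Mathlib `Representation.char_linHom`, transported from
`E →ₗ[ℂ] F` to `E →L[ℂ] F`). [cite: BrockerTomDieck1985, II (4.11)] -/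
theorem trace_conjCLM_rep (g : G) :
    LinearMap.trace ℂ (E →L[ℂ] F) (conjCLM (σ g) (π g⁻¹) : (E →L[ℂ] F) →ₗ[ℂ] (E →L[ℂ] F)) =
      character π g⁻¹ * character σ g := by
  -- transport Mathlib's `Representation.linHom π σ g : f ↦ σ g ∘ f ∘ π g⁻¹` on `E →ₗ[ℂ] F` to `E →L[ℂ] F`
  set e₂ : (E →ₗ[ℂ] F) ≃ₗ[ℂ] (E →L[ℂ] F) := LinearMap.toContinuousLinearMap with he₂
  have hconj : (conjCLM (σ g) (π g⁻¹) : (E →L[ℂ] F) →ₗ[ℂ] (E →L[ℂ] F)) =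
      e₂.conj (Representation.linHom π.toRepresentation σ.toRepresentation g) := by
    refine LinearMap.ext fun f => ?_
    rw [LinearEquiv.conj_apply_apply]
    refine ContinuousLinearMap.ext fun v => ?_
    simp [he₂, LinearMap.toContinuousLinearMap]
    rfl
  rw [hconj, LinearMap.trace_conj']
  exact Representation.char_linHom π.toRepresentation σ.toRepresentation g

omit [μ.IsMulLeftInvariant] in
/-- … and `Tr(avgOp) = ∫ Tr(f ↦ σ g ∘ f ∘ π g⁻¹) dμ = ∫ χ_π(g⁻¹) χ_σ(g) dμ` (the trace, written in a basis of `Hom(E, F)`,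
is a finite sum of coordinates, each of which passes under the Bochner integral). [cite: BrockerTomDieck1985, II (4.11)] -/
theorem trace_avgOp_eq_integral (hπ : Continuous (π : G → E →L[ℂ] E)) (hσ : Continuous (σ : G → F →L[ℂ] F)) :
    LinearMap.trace ℂ (E →L[ℂ] F) (avgOp μ π σ hπ hσ) = ∫ g, character π g⁻¹ * character σ g ∂μ := by
  classical
  haveI : CompleteSpace F := FiniteDimensional.complete ℂ F
  set b := Module.finBasis ℂ (E →L[ℂ] F) with hb
  -- each diagonal coordinate of `avgOp` is an integral
  have hcoord : ∀ k, b.repr (avgOp μ π σ hπ hσ (b k)) k = ∫ g, b.repr ((σ g).comp ((b k).comp (π g⁻¹))) k ∂μ := by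
    intro k
    have h := (LinearMap.toContinuousLinearMap (b.coord k)).integral_comp_comm (integrable_conjOp μ hπ hσ (b k))
    simp only [LinearMap.coe_toContinuousLinearMap', Module.Basis.coord_apply] at h
    rw [avgOp_apply, avg, ← h]
  have hint : ∀ k, Integrable (fun g : G => b.repr ((σ g).comp ((b k).comp (π g⁻¹))) k) μ := fun k =>
    ((LinearMap.toContinuousLinearMap (b.coord k)).continuous.comp
      (continuous_conjOp hπ hσ (b k))).integrable_of_hasCompactSupport (HasCompactSupport.of_compactSpace _)
  rw [LinearMap.trace_eq_matrix_trace ℂ b, Matrix.trace]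
  simp only [Matrix.diag_apply, LinearMap.toMatrix_apply]
  rw [Finset.sum_congr rfl fun k _ => hcoord k, ← integral_finsetSum _ fun k _ => hint k]
  refine integral_congr_ae (Filter.Eventually.of_forall fun g => ?_)
  beta_reduce
  rw [← trace_conjCLM_rep, LinearMap.trace_eq_matrix_trace ℂ b, Matrix.trace]
  simp only [Matrix.diag_apply, LinearMap.toMatrix_apply, ContinuousLinearMap.coe_coe, conjCLM_apply]

/-- **Bröcker–tom Dieck II Thm. (4.11) — the multiplicity formula**: for a unitary finite-dimensional continuous
representation `π` and a finite-dimensional continuous representation `σ` of a compact group `G` with normalised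
(left-invariant probability) measure `μ`, `dim_ℂ Hom_G(π, σ) = ∫ conj χ_π(g) · χ_σ(g) dμ(g) = ⟨χ_σ, χ_π⟩`.
[cite: BrockerTomDieck1985, II Thm (4.11)] -/
theorem finrank_intertwiners_eq_integral (hπ : Continuous (π : G → E →L[ℂ] E))
    (hσ : Continuous (σ : G → F →L[ℂ] F)) (hu : ∀ (g : G) (v w : E), ⟪π g v, π g w⟫_ℂ = ⟪v, w⟫_ℂ) :
    (Module.finrank ℂ (intertwiners π σ) : ℂ) = ∫ g, conj (character π g) * character σ g ∂μ := by
  rw [← trace_avgOp μ hπ hσ, trace_avgOp_eq_integral μ hπ hσ]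
  simp_rw [character_inv hu]

/-! ### In terms of Mathlib's `Representation.IntertwiningMap` -/

variable (π σ) in
/-- **`Hom_G` as continuous operators is `Hom_G` as linear maps** in finite dimension: the linear equivalence between
`intertwiners π σ` and Mathlib's `Representation.IntertwiningMap π.toRepresentation σ.toRepresentation` (every
linear map on a finite-dimensional space is continuous, `LinearMap.toContinuousLinearMap`).
[cite: BrockerTomDieck1985, II (4.1)] -/
def intertwinersEquiv :
    intertwiners π σ ≃ₗ[ℂ] Representation.IntertwiningMap π.toRepresentation σ.toRepresentation where
  toFun f :=
    { toLinearMap := ((f : E →L[ℂ] F) : E →ₗ[ℂ] F)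
      isIntertwining' := fun g => by
        refine LinearMap.ext fun v => ?_
        have h := congrArg (fun T : E →L[ℂ] F => T v) (f.2 g)
        exact h.symm }
  invFun T :=
    ⟨LinearMap.toContinuousLinearMap T.toLinearMap, fun g => by
      refine ContinuousLinearMap.ext fun v => ?_
      have h := congrArg (fun S : E →ₗ[ℂ] F => S v) (T.isIntertwining' g)
      simp only [LinearMap.comp_apply] at h
      simp only [ContinuousLinearMap.comp_apply, LinearMap.coe_toContinuousLinearMap']
      exact h.symm⟩
  map_add' _ _ := rfl
  map_smul' _ _ := rfl
  left_inv f := by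
    apply Subtype.ext
    exact ContinuousLinearMap.coe_injective rfl
  right_inv T := by
    apply Representation.IntertwiningMap.ext
    rfl

/-- **Bröcker–tom Dieck II Thm. (4.11), Mathlib form**: `dim_ℂ IntertwiningMap(π, σ) = ∫ conj χ_π · χ_σ dμ` for
unitary `π`. [cite: BrockerTomDieck1985, II Thm (4.11)] -/
theorem finrank_intertwiningMap_eq_integral (hπ : Continuous (π : G → E →L[ℂ] E))
    (hσ : Continuous (σ : G → F →L[ℂ] F)) (hu : ∀ (g : G) (v w : E), ⟪π g v, π g w⟫_ℂ = ⟪v, w⟫_ℂ) :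
    (Module.finrank ℂ (Representation.IntertwiningMap π.toRepresentation σ.toRepresentation) : ℂ) =
      ∫ g, conj (character π g) * character σ g ∂μ := by
  rw [← (intertwinersEquiv π σ).finrank_eq, finrank_intertwiners_eq_integral μ hπ hσ hu]

/-- **Irreducible representations with orthogonal characters admit no non-zero intertwiner**, and conversely
**`∫ conj χ_π χ_σ ≠ 0` forces a non-zero intertwiner** — the character detects `Hom_G` (II (4.11)–(4.12)).
[cite: BrockerTomDieck1985, II Thm (4.11)] -/
theorem nonempty_intertwiners_ne_zero_iff (hπ : Continuous (π : G → E →L[ℂ] E))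
    (hσ : Continuous (σ : G → F →L[ℂ] F)) (hu : ∀ (g : G) (v w : E), ⟪π g v, π g w⟫_ℂ = ⟪v, w⟫_ℂ) :
    (∃ f ∈ intertwiners π σ, f ≠ 0) ↔ ∫ g, conj (character π g) * character σ g ∂μ ≠ 0 := by
  rw [← finrank_intertwiners_eq_integral μ hπ hσ hu, Nat.cast_ne_zero, ← Nat.pos_iff_ne_zero,
    Module.finrank_pos_iff_exists_ne_zero]
  constructor
  · rintro ⟨f, hf, hne⟩
    exact ⟨⟨f, hf⟩, fun h => hne (congrArg Subtype.val h)⟩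
  · rintro ⟨f, hne⟩
    exact ⟨f.1, f.2, fun h => hne (Subtype.ext h)⟩

/-! ### `dim V^G = ∫ χ_V dμ` (II (4.11)(i)) -/

omit [IsTopologicalGroup G] [FiniteDimensional ℂ E] [μ.IsMulLeftInvariant] in
/-- Orbit maps `g ↦ π g v` of a norm-continuous representation are integrable over the compact group (continuous,
finite measure). [cite: BrockerTomDieck1985, II (4.1)] -/
private theorem integrable_apply_vec (hπ : Continuous (π : G → E →L[ℂ] E)) (v : E) :
    Integrable (fun g : G => π g v) μ :=
  (hπ.clm_apply continuous_const).integrable_of_hasCompactSupport (HasCompactSupport.of_compactSpace _)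

variable (π) in
/-- The vector-averaging operator `v ↦ ∫ π g v dμ(g)` on `E` (the projection `p : V → V^G` of Bröcker–tom Dieck
II (4.1)), as a linear endomorphism. [cite: BrockerTomDieck1985, II (4.1)] -/
def vecAvg (hπ : Continuous (π : G → E →L[ℂ] E)) : E →ₗ[ℂ] E where
  toFun v := ∫ g, π g v ∂μ
  map_add' v w := by
    simp only [map_add]
    exact integral_add (integrable_apply_vec μ hπ v) (integrable_apply_vec μ hπ w)
  map_smul' c v := by
    simp only [map_smul, RingHom.id_apply]
    exact integral_smul c _

omit [IsTopologicalGroup G] [FiniteDimensional ℂ E] [μ.IsMulLeftInvariant] in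
/-- Unfolding `vecAvg`. [cite: BrockerTomDieck1985, II (4.1)] -/
@[simp] theorem vecAvg_apply (hπ : Continuous (π : G → E →L[ℂ] E)) (v : E) : vecAvg μ π hπ v = ∫ g, π g v ∂μ := rfl

/-- **Bröcker–tom Dieck II (4.1)**: `v ↦ ∫ π g v dμ` is a projection of `V` onto the invariants `V^G`
(left invariance of `μ`). [cite: BrockerTomDieck1985, II (4.1)] -/
theorem isProj_vecAvg (hπ : Continuous (π : G → E →L[ℂ] E)) :
    LinearMap.IsProj π.toRepresentation.invariants (vecAvg μ π hπ) where
  map_mem v := by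
    haveI : CompleteSpace E := FiniteDimensional.complete ℂ E
    rw [Representation.mem_invariants]
    intro h
    change π h (∫ g, π g v ∂μ) = ∫ g, π g v ∂μ
    rw [← (π h).integral_comp_comm (integrable_apply_vec μ hπ v)]
    calc ∫ g, π h (π g v) ∂μ = ∫ g, (fun g : G => π g v) (h * g) ∂μ := by
          refine integral_congr_ae (Filter.Eventually.of_forall fun g => ?_)
          simp only [map_mul, ContinuousLinearMap.mul_def, ContinuousLinearMap.comp_apply]
      _ = ∫ g, π g v ∂μ := integral_mul_left_eq_self (fun g : G => π g v) h
  map_id v hv := by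
    rw [Representation.mem_invariants] at hv
    have h : (fun g : G => π g v) = fun _ => v := funext fun g => hv g
    change ∫ g, π g v ∂μ = v
    rw [h]
    simp

/-- Hence `Tr(vecAvg) = dim V^G`. [cite: BrockerTomDieck1985, II (4.11)] -/
theorem trace_vecAvg (hπ : Continuous (π : G → E →L[ℂ] E)) :
    LinearMap.trace ℂ E (vecAvg μ π hπ) = (Module.finrank ℂ π.toRepresentation.invariants : ℂ) :=
  (isProj_vecAvg μ hπ).trace

omit [IsTopologicalGroup G] [μ.IsMulLeftInvariant] in
/-- … and `Tr(vecAvg) = ∫ Tr(π g) dμ = ∫ χ_π dμ` (trace through the integral, coordinatewise in a basis).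
[cite: BrockerTomDieck1985, II (4.11)] -/
theorem trace_vecAvg_eq_integral (hπ : Continuous (π : G → E →L[ℂ] E)) :
    LinearMap.trace ℂ E (vecAvg μ π hπ) = ∫ g, character π g ∂μ := by
  classical
  haveI : CompleteSpace E := FiniteDimensional.complete ℂ E
  set b := Module.finBasis ℂ E with hb
  have hcoord : ∀ k, b.repr (vecAvg μ π hπ (b k)) k = ∫ g, b.repr (π g (b k)) k ∂μ := by
    intro k
    have h := (LinearMap.toContinuousLinearMap (b.coord k)).integral_comp_comm (integrable_apply_vec μ hπ (b k))
    simp only [LinearMap.coe_toContinuousLinearMap', Module.Basis.coord_apply] at h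
    rw [vecAvg_apply, ← h]
  have hint : ∀ k, Integrable (fun g : G => b.repr (π g (b k)) k) μ := fun k =>
    ((LinearMap.toContinuousLinearMap (b.coord k)).continuous.comp
      (hπ.clm_apply continuous_const)).integrable_of_hasCompactSupport (HasCompactSupport.of_compactSpace _)
  rw [LinearMap.trace_eq_matrix_trace ℂ b, Matrix.trace]
  simp only [Matrix.diag_apply, LinearMap.toMatrix_apply]
  rw [Finset.sum_congr rfl fun k _ => hcoord k, ← integral_finsetSum _ fun k _ => hint k]
  refine integral_congr_ae (Filter.Eventually.of_forall fun g => ?_)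
  beta_reduce
  rw [character, LinearMap.trace_eq_matrix_trace ℂ b, Matrix.trace]
  simp only [Matrix.diag_apply, LinearMap.toMatrix_apply, ContinuousLinearMap.coe_coe]

/-- **Bröcker–tom Dieck II Thm. (4.11)(i)**: `dim_ℂ V^G = ∫ χ_V(g) dμ(g)` for a finite-dimensional continuous
representation of a compact group (`V^G` = Mathlib `Representation.invariants`). [cite: BrockerTomDieck1985, II Thm (4.11)] -/
theorem finrank_invariants_eq_integral_character (hπ : Continuous (π : G → E →L[ℂ] E)) :
    (Module.finrank ℂ π.toRepresentation.invariants : ℂ) = ∫ g, character π g ∂μ := by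
  rw [← trace_vecAvg μ hπ, trace_vecAvg_eq_integral μ hπ]

/-! ### Consequences: (4.11)(iii) for isomorphic irreducibles; the irreducibility criterion (4.13) -/

omit [TopologicalSpace G] [IsTopologicalGroup G] [MeasurableSpace G] [BorelSpace G] [CompactSpace G]
  [FiniteDimensional ℂ E] [FiniteDimensional ℂ F] in
/-- **Isomorphic representations have equal characters** (Bröcker–tom Dieck II (4.10)(ii); Mathlib
`Representation.char_iso`). [cite: BrockerTomDieck1985, II Prop (4.10)] -/
theorem character_eq_of_equiv (e : π.toRepresentation.Equiv σ.toRepresentation) : character π = character σ :=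
  Representation.char_iso e

omit [FiniteDimensional ℂ F] in
/-- **Bröcker–tom Dieck II Thm. (4.11)(iii), isomorphic case**: for an irreducible unitary `π` and `σ ≅ π`,
`∫ conj χ_π χ_σ dμ = 1`. [cite: BrockerTomDieck1985, II Thm (4.11)] -/
theorem integral_conj_character_mul_character_of_equiv (hπ : Continuous (π : G → E →L[ℂ] E))
    [π.toRepresentation.IsIrreducible] (hu : ∀ (g : G) (v w : E), ⟪π g v, π g w⟫_ℂ = ⟪v, w⟫_ℂ)
    (e : π.toRepresentation.Equiv σ.toRepresentation) :
    ∫ g, conj (character π g) * character σ g ∂μ = 1 := by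
  rw [← character_eq_of_equiv e]
  exact integral_conj_character_mul_character μ hπ hu

omit [TopologicalSpace G] [IsTopologicalGroup G] [MeasurableSpace G] [BorelSpace G] [CompactSpace G]
  [FiniteDimensional ℂ E] in
/-- For a unitary `π` and an invariant subspace `W`, the orthogonal projection onto `W` commutes with `π g`
(`π g` preserves `W` and, being unitary, `Wᗮ`). [cite: BrockerTomDieck1985, II (1.9)] -/
theorem starProjection_apply_comm (hu : ∀ (g : G) (v w : E), ⟪π g v, π g w⟫_ℂ = ⟪v, w⟫_ℂ)
    (W : Subrepresentation π.toRepresentation) [W.toSubmodule.HasOrthogonalProjection] (g : G) (v : E) :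
    W.toSubmodule.starProjection (π g v) = π g (W.toSubmodule.starProjection v) := by
  -- `π g` preserves `W` and `Wᗮ`
  have hmem : ∀ x ∈ W.toSubmodule, π g x ∈ W.toSubmodule := fun x hx => W.apply_mem_toSubmodule g hx
  have horth : ∀ x ∈ W.toSubmoduleᗮ, π g x ∈ W.toSubmoduleᗮ := fun x hx => by
    rw [Submodule.mem_orthogonal] at hx ⊢
    intro u hu'
    rw [← apply_apply_inv (π := π) g u, hu g]
    exact hx _ (W.apply_mem_toSubmodule g⁻¹ hu')
  have hsplit : π g v = π g (W.toSubmodule.starProjection v) + π g (v - W.toSubmodule.starProjection v) := by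
    rw [← map_add, add_sub_cancel]
  rw [hsplit, map_add, Submodule.starProjection_eq_self_iff.mpr
      (hmem _ (W.toSubmodule.starProjection_apply_mem v)),
    (Submodule.starProjection_apply_eq_zero_iff _).mpr
      (horth _ (W.toSubmodule.sub_starProjection_mem_orthogonal v)), add_zero]

/-- **Bröcker–tom Dieck II Prop. (4.13) — the irreducibility criterion**: a unitary finite-dimensional continuous
representation `π` of a compact group with `⟨χ_π, χ_π⟩ = ∫ |χ_π|² dμ = 1` is irreducible.  (By (4.11)(ii),
`dim End_G(π) = 1`; were `W` a proper non-zero invariant subspace, the orthogonal projection onto `W` would be a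
non-scalar intertwiner.) [cite: BrockerTomDieck1985, II Prop (4.13)] -/
theorem isIrreducible_of_integral_conj_character_mul_character_eq_one (hπ : Continuous (π : G → E →L[ℂ] E))
    (hu : ∀ (g : G) (v w : E), ⟪π g v, π g w⟫_ℂ = ⟪v, w⟫_ℂ) (h : ∫ g, conj (character π g) * character π g ∂μ = 1) :
    π.toRepresentation.IsIrreducible := by
  classical
  -- `dim End_G(π) = 1`
  have h1 : Module.finrank ℂ (Representation.IntertwiningMap π.toRepresentation π.toRepresentation) = 1 := by
    have h' := finrank_intertwiningMap_eq_integral μ hπ hπ hu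
    rw [h] at h'
    exact_mod_cast h'
  -- so `E ≠ 0`
  haveI hE : Nontrivial E := by
    by_contra htriv
    rw [not_nontrivial_iff_subsingleton] at htriv
    haveI : Subsingleton (Representation.IntertwiningMap π.toRepresentation π.toRepresentation) :=
      ⟨fun f₁ f₂ => Representation.IntertwiningMap.ext (LinearMap.ext fun v => Subsingleton.elim _ _)⟩
    rw [Module.finrank_zero_of_subsingleton] at h1
    exact zero_ne_one h1
  haveI : Nontrivial (Subrepresentation π.toRepresentation) :=
    ⟨⟨⊥, ⊤, fun hbt => bot_ne_top (congrArg Subrepresentation.toSubmodule hbt : (⊥ : Submodule ℂ E) = ⊤)⟩⟩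
  refine ⟨fun W => ?_⟩
  by_contra hW
  push Not at hW
  obtain ⟨hWb, hWt⟩ := hW
  set U : Submodule ℂ E := W.toSubmodule with hU
  haveI : CompleteSpace U := FiniteDimensional.complete ℂ U
  -- the orthogonal projection onto `W` is an intertwiner …
  let p : Representation.IntertwiningMap π.toRepresentation π.toRepresentation :=
    { toLinearMap := ((U.starProjection : E →L[ℂ] E) : E →ₗ[ℂ] E)
      isIntertwining' := fun g => LinearMap.ext fun v => starProjection_apply_comm hu W g v }
  -- … hence a scalar `c • 1`
  have hone : (1 : Representation.IntertwiningMap π.toRepresentation π.toRepresentation) ≠ 0 := by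
    obtain ⟨v, hv⟩ := exists_ne (0 : E)
    intro h0
    have := congrArg (fun T : Representation.IntertwiningMap π.toRepresentation π.toRepresentation => T v) h0
    exact hv this
  obtain ⟨c, hc⟩ := (finrank_eq_one_iff_of_nonzero' (1 : Representation.IntertwiningMap π.toRepresentation
    π.toRepresentation) hone).mp h1 p
  have hp : ∀ v : E, U.starProjection v = c • v := fun v => by
    have := congrArg (fun T : Representation.IntertwiningMap π.toRepresentation π.toRepresentation => T v) hc
    exact this.symm
  -- `W ≠ 0` forces `c = 1` …
  have hUb : U ≠ ⊥ := fun hb => hWb (Subrepresentation.toSubmodule_injective hb)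
  obtain ⟨u, huU, hu0⟩ := Submodule.exists_mem_ne_zero_of_ne_bot hUb
  have hc1 : c = 1 := by
    have hu' : U.starProjection u = u := Submodule.starProjection_eq_self_iff.mpr huU
    rw [hp u] at hu'
    have : (c - 1) • u = 0 := by rw [sub_smul, one_smul, hu', sub_self]
    exact sub_eq_zero.mp ((smul_eq_zero.mp this).resolve_right hu0)
  -- … and then `W = E`
  refine hWt (Subrepresentation.toSubmodule_injective (Submodule.eq_top_iff'.mpr fun v => ?_))
  change v ∈ U
  rw [← Submodule.starProjection_eq_self_iff, hp v, hc1, one_smul]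

/-- **The irreducibility criterion, iff form** (Bröcker–tom Dieck II (4.11)(iii) with Prop. (4.13)): a unitary
finite-dimensional continuous representation of a compact group is irreducible iff `∫ |χ_π|² dμ = 1`.
[cite: BrockerTomDieck1985, II Prop (4.13)] -/
theorem isIrreducible_iff_integral_conj_character_mul_character_eq_one (hπ : Continuous (π : G → E →L[ℂ] E))
    (hu : ∀ (g : G) (v w : E), ⟪π g v, π g w⟫_ℂ = ⟪v, w⟫_ℂ) :
    π.toRepresentation.IsIrreducible ↔ ∫ g, conj (character π g) * character π g ∂μ = 1 :=
  ⟨fun _ => integral_conj_character_mul_character μ hπ hu,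
    isIrreducible_of_integral_conj_character_mul_character_eq_one μ hπ hu⟩

end Projection

end Schur

end Literature.RepresentationTheory.CompactGroups

end
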